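import Literature.Computability.MetaComplexity.EFAdder
import Literature.Computability.MetaComplexity.EFRuleCheck
import HarnessLib

/-!
# Laws of the ripple-carry adder in extended Frege: congruence, zero, cancellation, associativity

Layer C/2 of the `EF`-proof construction kit: the elementary laws of binary addition as
polynomial-size blocks of constant-size sound inferences over adder *views* (`EFAdder.lean`),
for any context `K`, any available set `Γ` containing the definitions, and any rule list
containing the layer's rules.

## Content

* `Adder.View.Avail.congr`: availability transfers along pointwise equal operand words.
* `Adder.isBlock_leibLines`: congruence — adders with provably equal operands have provably
  equal carries and sums (Leibniz rules of `EFNetlist.lean`).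
* `Adder.isBlock_zeroLines`: `x + 0 = x` with no carries, from provably false second-operand
  bits.
* `Adder.isBlock_cancelLines`: cancellation `x + z = y + z ⟹ x = y`, read off from the least
  significant end.
* `Adder.AssocData.isBlock_lines`: associativity `(u + v) + z = u + (v + z)` on `W+1` bits (the
  `W`-bit operands padded by a provably false variable), by the carry invariant
  `cᵢ(A) + cᵢ(B) = cᵢ(C) + cᵢ(D)` (`Adder.invF`); its 14-metavariable step rule is verified by
  the definitional-extension checker `FregeRule.checkD` (`EFRuleCheck.lean`).
* The rules `Adder.lawRules` with `Adder.isSound_of_mem_lawRules`.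

## Sources

* S. A. Cook, R. A. Reckhow, *The relative efficiency of propositional proof systems*,
  J. Symbolic Logic 44 (1979), §2 (sound schematic rules).
* S. R. Buss, *Bounded Arithmetic* (Bibliopolis 1986), and J. Krajíček, *Bounded Arithmetic,
  Propositional Logic, and Complexity Theory* (CUP 1995), §9.2: polynomial-size `EF` proofs of
  the laws of binary arithmetic via the translation of `S¹₂`; here constructed directly.
-/

namespace Literature.Computability.MetaComplexity

open _root_.Computability Complexity Complexity.PropForm Netlist

namespace Adder

variable {G : FregeSystem} {K : PropForm ℕ} {Γ : Set (PropForm ℕ)} {W : ℕ}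

/-- Availability of a view transfers along pointwise equal operand functions (on the used
positions) and equal bases. [folklore] -/
theorem View.Avail.congr {V V' : View} {K : PropForm ℕ} {Γ : Set (PropForm ℕ)} {c₀ : Bool} {W : ℕ}
    (h : V.Avail K Γ c₀ W) (hb : V'.base = V.base) (hx : ∀ i < W, V'.x i = V.x i)
    (hy : ∀ i < W, V'.y i = V.y i) : V'.Avail K Γ c₀ W := by
  obtain ⟨b, x, y⟩ := V
  obtain ⟨b', x', y'⟩ := V'
  simp only at hb hx hy
  subst hb
  refine ⟨h.1, fun i hi => ?_⟩
  have h₁ := (h.2 i hi).1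
  have h₂ := (h.2 i hi).2
  simp only [View.sumDef, View.carryDef, View.s, View.c, View.wire] at h₁ h₂ ⊢
  rw [hx i hi, hy i hi]
  exact ⟨h₁, h₂⟩

/-! ### Law: congruence (Leibniz) for adder views -/

/-- The lines of the congruence law: wire-by-wire equality of two adders with provably equal
operands. [folklore] -/
def leibLines (P Q : View) (K : PropForm ℕ) (W : ℕ) : List (PropForm ℕ) :=
  (List.range (2 * W + 1)).map fun k => ctx K (eqv (P.wire k) (Q.wire k))

/-- **Congruence of ripple-carry addition inside Frege**: two adders (same width and carry-in)
with provably equal operands have provably equal carries and sum bits (one Leibniz inference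
per gate). [cite: CookReckhow1979, §2] -/
theorem isBlock_leibLines (hGN : ∀ r ∈ Netlist.rules, r ∈ G.rules) {c₀ : Bool} (P Q : View)
    (hP : P.Avail K Γ c₀ W) (hQ : Q.Avail K Γ c₀ W)
    (hx : ∀ i < W, ctx K (eqv (P.x i) (Q.x i)) ∈ Γ) (hy : ∀ i < W, ctx K (eqv (P.y i) (Q.y i)) ∈ Γ) :
    G.IsBlock Γ (leibLines P Q K W) := by
  refine isBlock_map_range (2 * W + 1) fun k hk => Or.inr ?_
  rcases index_cases W k hk with rfl | ⟨i, hi, rfl | rfl⟩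
  · exact FregeSystem.IsInferredFrom.of_rule (hGN _ (rLeib_mem_rules (Kind.cst c₀)))
      (FregeSystem.sub [K, var (P.c 0), const true, const true, const true, var (Q.c 0)])
      rfl (FregeSystem.prems_cons (Or.inl hP.1) (FregeSystem.prems_cons (Or.inl hQ.1)
        FregeSystem.prems_nil))
  · exact FregeSystem.IsInferredFrom.of_rule (hGN _ (rLeib_mem_rules Kind.xor3))
      (FregeSystem.sub [K, var (P.s i), var (P.x i), var (P.y i), var (P.c i), var (Q.s i),
        var (Q.x i), var (Q.y i), var (Q.c i)])
      rfl (FregeSystem.prems_cons (Or.inl (hP.2 i hi).1) (FregeSystem.prems_cons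
        (Or.inl (hQ.2 i hi).1) (FregeSystem.prems_cons (Or.inl (hx i hi))
        (FregeSystem.prems_cons (Or.inl (hy i hi)) (FregeSystem.prems_cons
        (Or.inr ⟨2 * i, by omega, rfl⟩) FregeSystem.prems_nil)))))
  · exact FregeSystem.IsInferredFrom.of_rule (hGN _ (rLeib_mem_rules Kind.maj))
      (FregeSystem.sub [K, var (P.c (i + 1)), var (P.x i), var (P.y i), var (P.c i),
        var (Q.c (i + 1)), var (Q.x i), var (Q.y i), var (Q.c i)])
      rfl (FregeSystem.prems_cons (Or.inl (hP.2 i hi).2) (FregeSystem.prems_cons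
        (Or.inl (hQ.2 i hi).2) (FregeSystem.prems_cons (Or.inl (hx i hi))
        (FregeSystem.prems_cons (Or.inl (hy i hi)) (FregeSystem.prems_cons
        (Or.inr ⟨2 * i, by omega, rfl⟩) FregeSystem.prems_nil)))))

/-- Conclusions of the congruence law: every wire, in particular the sum bits and the
carry-out, of the two adders are provably equal. [folklore] -/
theorem mem_leibLines {P Q : View} {K : PropForm ℕ} {W k : ℕ} (hk : k < 2 * W + 1) :
    ctx K (eqv (P.wire k) (Q.wire k)) ∈ leibLines P Q K W :=
  mem_map_range hk

/-- Size of the congruence law. [folklore] -/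
theorem proofSize_leibLines (P Q : View) (K : PropForm ℕ) (W : ℕ) :
    proofSize (leibLines P Q K W) ≤ (2 * W + 1) * (K.size + 10) :=
  proofSize_map_range_le fun k _ => by simp [ctx, eqv, size, FregeSystem.size_biimp]

/-! ### Law: adding zero -/

/-- `c ↔ ⊥ ⊢ ¬c` (under a context). [cite: CookReckhow1979, §2 (sound rule)] -/
def rZeroCin : FregeRule := ⟨[ctx (var 0) (biimp (var 1) (const false))], ctx (var 0) (neg (var 1))⟩

/-- `s = x ⊕ y ⊕ c`, `¬y`, `¬c` give `s ↔ x`. [cite: CookReckhow1979, §2 (sound rule)] -/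
def rZeroSum : FregeRule :=
  ⟨[ctx (var 0) (biimp (var 1) (xor3F (var 2) (var 3) (var 4))), ctx (var 0) (neg (var 3)),
    ctx (var 0) (neg (var 4))], ctx (var 0) (eqv 1 2)⟩

/-- `c⁺ = maj(x, y, c)`, `¬y`, `¬c` give `¬c⁺`. [cite: CookReckhow1979, §2 (sound rule)] -/
def rZeroCarry : FregeRule :=
  ⟨[ctx (var 0) (biimp (var 1) (majF (var 2) (var 3) (var 4))), ctx (var 0) (neg (var 3)),
    ctx (var 0) (neg (var 4))], ctx (var 0) (neg (var 1))⟩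

/-! ### Law: cancellation -/

/-- `s = x ⊕ z ⊕ c`, `s' = y ⊕ z' ⊕ c'` with `s ↔ s'`, `z ↔ z'`, `c ↔ c'` give `x ↔ y`.
[cite: CookReckhow1979, §2 (sound rule)] -/
def rCancelSum : FregeRule :=
  ⟨[ctx (var 0) (biimp (var 1) (xor3F (var 2) (var 3) (var 4))),
    ctx (var 0) (biimp (var 5) (xor3F (var 6) (var 7) (var 8))),
    ctx (var 0) (eqv 1 5), ctx (var 0) (eqv 3 7), ctx (var 0) (eqv 4 8)],
   ctx (var 0) (eqv 2 6)⟩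

/-! ### Law: associativity -/

/-- The carry invariant of associativity: `cA + cB = cC + cD` as numbers, i.e. equal parities
and equal conjunctions. [folklore] -/
def invF (cA cB cC cD : PropForm ℕ) : PropForm ℕ :=
  conj (biimp (biimp cA cB) (biimp cC cD)) (biimp (conj cA cB) (conj cC cD))

/-- The base case of the invariant: four `⊥` carry-ins. [cite: CookReckhow1979, §2 (sound rule)] -/
def rAssocBase : FregeRule :=
  ⟨[ctx (var 0) (biimp (var 1) (const false)), ctx (var 0) (biimp (var 2) (const false)),
    ctx (var 0) (biimp (var 3) (const false)), ctx (var 0) (biimp (var 4) (const false))],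
   ctx (var 0) (invF (var 1) (var 2) (var 3) (var 4))⟩

/-- The sum step of associativity (metavariables: `u v z` = 1 2 3, carries `cA cB cC cD` = 4–7,
`sA sC sB sD` = 8–11): from the invariant and the four sum definitions infer `sB ↔ sD`.
[cite: CookReckhow1979, §2 (sound rule)] -/
def rAssocSum : FregeRule :=
  ⟨[ctx (var 0) (invF (var 4) (var 5) (var 6) (var 7)),
    ctx (var 0) (biimp (var 8) (xor3F (var 1) (var 2) (var 4))),
    ctx (var 0) (biimp (var 9) (xor3F (var 2) (var 3) (var 6))),
    ctx (var 0) (biimp (var 10) (xor3F (var 8) (var 3) (var 5))),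
    ctx (var 0) (biimp (var 11) (xor3F (var 1) (var 9) (var 7)))],
   ctx (var 0) (eqv 10 11)⟩

/-- The carry step of associativity (metavariables: `u v z` = 1 2 3, carries = 4–7, `sA sC` = 8 9,
next carries `cA' cB' cC' cD'` = 10–13): the invariant propagates.
[cite: CookReckhow1979, §2 (sound rule)] -/
def rAssocCarry : FregeRule :=
  ⟨[ctx (var 0) (invF (var 4) (var 5) (var 6) (var 7)),
    ctx (var 0) (biimp (var 8) (xor3F (var 1) (var 2) (var 4))),
    ctx (var 0) (biimp (var 9) (xor3F (var 2) (var 3) (var 6))),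
    ctx (var 0) (biimp (var 10) (majF (var 1) (var 2) (var 4))),
    ctx (var 0) (biimp (var 11) (majF (var 8) (var 3) (var 5))),
    ctx (var 0) (biimp (var 12) (majF (var 2) (var 3) (var 6))),
    ctx (var 0) (biimp (var 13) (majF (var 1) (var 9) (var 7)))],
   ctx (var 0) (invF (var 10) (var 11) (var 12) (var 13))⟩

/-- The top sum bit of associativity (carries = 1–4, false top operand bits `f f'` = 5 6,
`sB sD` = 7 8): `sB_W = cA ⊕ f ⊕ cB`, `sD_W = f' ⊕ cC ⊕ cD` are equal.
[cite: CookReckhow1979, §2 (sound rule)] -/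
def rAssocTopSum : FregeRule :=
  ⟨[ctx (var 0) (invF (var 1) (var 2) (var 3) (var 4)), ctx (var 0) (neg (var 5)),
    ctx (var 0) (neg (var 6)),
    ctx (var 0) (biimp (var 7) (xor3F (var 1) (var 5) (var 2))),
    ctx (var 0) (biimp (var 8) (xor3F (var 6) (var 3) (var 4)))],
   ctx (var 0) (eqv 7 8)⟩

/-- The top carry of associativity: `cB' = maj(cA, f, cB)` and `cD' = maj(f', cC, cD)` are
equal. [cite: CookReckhow1979, §2 (sound rule)] -/
def rAssocTopCarry : FregeRule :=
  ⟨[ctx (var 0) (invF (var 1) (var 2) (var 3) (var 4)), ctx (var 0) (neg (var 5)),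
    ctx (var 0) (neg (var 6)),
    ctx (var 0) (biimp (var 7) (majF (var 1) (var 5) (var 2))),
    ctx (var 0) (biimp (var 8) (majF (var 6) (var 3) (var 4)))],
   ctx (var 0) (eqv 7 8)⟩

/-- The rules of the adder-law layer. [cite: CookReckhow1979, §2] -/
def lawRules : List FregeRule :=
  [rZeroCin, rZeroSum, rZeroCarry, rCancelSum, rAssocBase, rAssocSum, rAssocCarry, rAssocTopSum,
    rAssocTopCarry]

/-- Soundness check of `rAssocCarry` (14 metavariables, 6 of them gate-defined: the
definitional-extension checker enumerates the 8 free ones). [cite: CookReckhow1979, §2 (sound rule)] -/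
theorem checkD_rAssocCarry : rAssocCarry.checkD 8
    [(8, xor3F (var 1) (var 2) (var 4)), (9, xor3F (var 2) (var 3) (var 6)),
      (10, majF (var 1) (var 2) (var 4)), (11, majF (var 8) (var 3) (var 5)),
      (12, majF (var 2) (var 3) (var 6)), (13, majF (var 1) (var 9) (var 7))] = true := by
  decide +kernel

/-- Soundness check of `rAssocSum`. [cite: CookReckhow1979, §2 (sound rule)] -/
theorem checkD_rAssocSum : rAssocSum.checkD 8
    [(8, xor3F (var 1) (var 2) (var 4)), (9, xor3F (var 2) (var 3) (var 6)),
      (10, xor3F (var 8) (var 3) (var 5)), (11, xor3F (var 1) (var 9) (var 7))] = true := by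
  decide +kernel

/-- Every rule of the adder-law layer is sound (truth tables). [cite: CookReckhow1979, §2 (sound rule)] -/
theorem isSound_of_mem_lawRules : ∀ r ∈ lawRules, r.IsSound := by
  intro r hr
  simp only [lawRules, List.mem_cons, List.not_mem_nil, or_false] at hr
  rcases hr with rfl | rfl | rfl | rfl | rfl | rfl | rfl | rfl | rfl
  · exact FregeRule.isSound_of_check (by decide +kernel)
  · exact FregeRule.isSound_of_check (by decide +kernel)
  · exact FregeRule.isSound_of_check (by decide +kernel)
  · exact FregeRule.isSound_of_check (by decide +kernel)
  · exact FregeRule.isSound_of_check (by decide +kernel)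
  · exact FregeRule.isSound_of_checkD checkD_rAssocSum
  · exact FregeRule.isSound_of_checkD checkD_rAssocCarry
  · exact FregeRule.isSound_of_check (by decide +kernel)
  · exact FregeRule.isSound_of_check (by decide +kernel)

/-- Membership in `lawRules`. [folklore] -/
theorem mem_lawRules :
    rZeroCin ∈ lawRules ∧ rZeroSum ∈ lawRules ∧ rZeroCarry ∈ lawRules ∧ rCancelSum ∈ lawRules ∧
      rAssocBase ∈ lawRules ∧ rAssocSum ∈ lawRules ∧ rAssocCarry ∈ lawRules ∧
      rAssocTopSum ∈ lawRules ∧ rAssocTopCarry ∈ lawRules := by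
  simp [lawRules]

/-! #### Adding zero -/

/-- The lines of the zero law: `¬cᵢ` (line `2i`) and `sᵢ ↔ xᵢ` (line `2i+1`). [folklore] -/
def zeroLine (P : View) (K : PropForm ℕ) (k : ℕ) : PropForm ℕ :=
  if k % 2 = 0 then ctx K (neg (var (P.c (k / 2)))) else ctx K (eqv (P.s (k / 2)) (P.x (k / 2)))

/-- The carry lines of the zero law. [folklore] -/
theorem zeroLine_even (P : View) (K : PropForm ℕ) (i : ℕ) :
    zeroLine P K (2 * i) = ctx K (neg (var (P.c i))) := by
  rw [zeroLine, if_pos (by omega), show 2 * i / 2 = i by omega]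

/-- The sum lines of the zero law. [folklore] -/
theorem zeroLine_odd (P : View) (K : PropForm ℕ) (i : ℕ) :
    zeroLine P K (2 * i + 1) = ctx K (eqv (P.s i) (P.x i)) := by
  rw [zeroLine, if_neg (by omega), show (2 * i + 1) / 2 = i by omega]

/-- The block of the zero law. [folklore] -/
def zeroLines (P : View) (K : PropForm ℕ) (W : ℕ) : List (PropForm ℕ) :=
  (List.range (2 * W + 1)).map (zeroLine P K)

/-- **Adding zero inside Frege**: for an adder `P` (carry-in `0`) whose second operand bits are
provably false, all carries are provably false and the sum bits are provably the first
operand. [cite: CookReckhow1979, §2] -/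
theorem isBlock_zeroLines (hG : ∀ r ∈ lawRules, r ∈ G.rules) (P : View) (hP : P.Avail K Γ false W)
    (hy : ∀ i < W, ctx K (neg (var (P.y i))) ∈ Γ) : G.IsBlock Γ (zeroLines P K W) := by
  refine isBlock_map_range (2 * W + 1) fun k hk => Or.inr ?_
  rcases index_cases W k hk with rfl | ⟨i, hi, rfl | rfl⟩
  · rw [show (0 : ℕ) = 2 * 0 from rfl, zeroLine_even]
    exact FregeSystem.IsInferredFrom.of_rule (hG _ mem_lawRules.1) (FregeSystem.sub [K, var (P.c 0)])
      rfl (FregeSystem.prems_cons (Or.inl hP.1) FregeSystem.prems_nil)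
  · rw [zeroLine_odd]
    exact FregeSystem.IsInferredFrom.of_rule (hG _ mem_lawRules.2.1)
      (FregeSystem.sub [K, var (P.s i), var (P.x i), var (P.y i), var (P.c i)]) rfl
      (FregeSystem.prems_cons (Or.inl (hP.2 i hi).1) (FregeSystem.prems_cons (Or.inl (hy i hi))
        (FregeSystem.prems_cons (Or.inr ⟨2 * i, by omega, (zeroLine_even P K i).symm⟩)
        FregeSystem.prems_nil)))
  · rw [show 2 * i + 2 = 2 * (i + 1) by ring, zeroLine_even]
    exact FregeSystem.IsInferredFrom.of_rule (hG _ mem_lawRules.2.2.1)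
      (FregeSystem.sub [K, var (P.c (i + 1)), var (P.x i), var (P.y i), var (P.c i)]) rfl
      (FregeSystem.prems_cons (Or.inl (hP.2 i hi).2) (FregeSystem.prems_cons (Or.inl (hy i hi))
        (FregeSystem.prems_cons (Or.inr ⟨2 * i, by omega, (zeroLine_even P K i).symm⟩)
        FregeSystem.prems_nil)))

/-- Conclusions of the zero law: `sᵢ ↔ xᵢ`. [folklore] -/
theorem sum_mem_zeroLines {P : View} {K : PropForm ℕ} {W i : ℕ} (hi : i < W) :
    ctx K (eqv (P.s i) (P.x i)) ∈ zeroLines P K W := by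
  rw [← zeroLine_odd P K i]
  exact mem_map_range (by omega)

/-- Conclusions of the zero law: `¬cᵢ` for `i ≤ W` (in particular no carry-out). [folklore] -/
theorem carry_mem_zeroLines {P : View} {K : PropForm ℕ} {W i : ℕ} (hi : i ≤ W) :
    ctx K (neg (var (P.c i))) ∈ zeroLines P K W := by
  rw [← zeroLine_even P K i]
  exact mem_map_range (by omega)

/-- Size of the zero law. [folklore] -/
theorem proofSize_zeroLines (P : View) (K : PropForm ℕ) (W : ℕ) :
    proofSize (zeroLines P K W) ≤ (2 * W + 1) * (K.size + 10) :=
  proofSize_map_range_le fun k _ => by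
    unfold zeroLine
    split_ifs <;> simp [ctx, eqv, size, FregeSystem.size_biimp]

/-! #### Cancellation -/

/-- The lines of the cancellation law for adders `P` on `(x, z)` and `Q` on `(y, z)` with equal
sums: `cᵢ(P) ↔ cᵢ(Q)` (line `2i`) and `xᵢ ↔ yᵢ` (line `2i+1`). [folklore] -/
def cancelLine (P Q : View) (K : PropForm ℕ) (k : ℕ) : PropForm ℕ :=
  if k % 2 = 0 then ctx K (eqv (P.c (k / 2)) (Q.c (k / 2))) else ctx K (eqv (P.x (k / 2)) (Q.x (k / 2)))

/-- The carry lines of the cancellation law. [folklore] -/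
theorem cancelLine_even (P Q : View) (K : PropForm ℕ) (i : ℕ) :
    cancelLine P Q K (2 * i) = ctx K (eqv (P.c i) (Q.c i)) := by
  rw [cancelLine, if_pos (by omega), show 2 * i / 2 = i by omega]

/-- The operand lines of the cancellation law. [folklore] -/
theorem cancelLine_odd (P Q : View) (K : PropForm ℕ) (i : ℕ) :
    cancelLine P Q K (2 * i + 1) = ctx K (eqv (P.x i) (Q.x i)) := by
  rw [cancelLine, if_neg (by omega), show (2 * i + 1) / 2 = i by omega]

/-- The block of the cancellation law (only the positions below `W` are needed: `2W` lines).
[folklore] -/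
def cancelLines (P Q : View) (K : PropForm ℕ) (W : ℕ) : List (PropForm ℕ) :=
  (List.range (2 * W)).map (cancelLine P Q K)

/-- **Cancellation inside Frege**: if two adders `P` on `(x, z)` and `Q` on `(y, z')` (same
carry-in) have provably equal second operands and provably equal sum bits, then their first
operands (and all carries) are provably equal — `x + z = y + z ⟹ x = y`, read off bit by bit
from the least significant end. [cite: CookReckhow1979, §2] -/
theorem isBlock_cancelLines (hGN : ∀ r ∈ Netlist.rules, r ∈ G.rules) (hG : ∀ r ∈ lawRules, r ∈ G.rules)
    {c₀ : Bool} (P Q : View) (hP : P.Avail K Γ c₀ W) (hQ : Q.Avail K Γ c₀ W)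
    (hz : ∀ i < W, ctx K (eqv (P.y i) (Q.y i)) ∈ Γ) (hs : ∀ i < W, ctx K (eqv (P.s i) (Q.s i)) ∈ Γ) :
    G.IsBlock Γ (cancelLines P Q K W) := by
  refine isBlock_map_range (2 * W) fun k hk => Or.inr ?_
  rcases index_cases W k (by omega) with rfl | ⟨i, hi, rfl | rfl⟩
  · rw [show (0 : ℕ) = 2 * 0 from rfl, cancelLine_even]
    exact FregeSystem.IsInferredFrom.of_rule (hGN _ (rLeib_mem_rules (Kind.cst c₀)))
      (FregeSystem.sub [K, var (P.c 0), const true, const true, const true, var (Q.c 0)])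
      rfl (FregeSystem.prems_cons (Or.inl hP.1) (FregeSystem.prems_cons (Or.inl hQ.1)
        FregeSystem.prems_nil))
  · rw [cancelLine_odd]
    exact FregeSystem.IsInferredFrom.of_rule (hG _ mem_lawRules.2.2.2.1)
      (FregeSystem.sub [K, var (P.s i), var (P.x i), var (P.y i), var (P.c i), var (Q.s i),
        var (Q.x i), var (Q.y i), var (Q.c i)]) rfl
      (FregeSystem.prems_cons (Or.inl (hP.2 i hi).1) (FregeSystem.prems_cons (Or.inl (hQ.2 i hi).1)
        (FregeSystem.prems_cons (Or.inl (hs i hi)) (FregeSystem.prems_cons (Or.inl (hz i hi))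
        (FregeSystem.prems_cons (Or.inr ⟨2 * i, by omega, (cancelLine_even P Q K i).symm⟩)
        FregeSystem.prems_nil)))))
  · have hiW : i + 1 < W := by omega
    rw [show 2 * i + 2 = 2 * (i + 1) by ring, cancelLine_even]
    exact FregeSystem.IsInferredFrom.of_rule (hGN _ (rLeib_mem_rules Kind.maj))
      (FregeSystem.sub [K, var (P.c (i + 1)), var (P.x i), var (P.y i), var (P.c i),
        var (Q.c (i + 1)), var (Q.x i), var (Q.y i), var (Q.c i)]) rfl
      (FregeSystem.prems_cons (Or.inl (hP.2 i hi).2) (FregeSystem.prems_cons (Or.inl (hQ.2 i hi).2)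
        (FregeSystem.prems_cons (Or.inr ⟨2 * i + 1, by omega, (cancelLine_odd P Q K i).symm⟩)
        (FregeSystem.prems_cons (Or.inl (hz i hi))
        (FregeSystem.prems_cons (Or.inr ⟨2 * i, by omega, (cancelLine_even P Q K i).symm⟩)
        FregeSystem.prems_nil)))))

/-- Conclusions of the cancellation law: `xᵢ ↔ yᵢ`. [folklore] -/
theorem mem_cancelLines {P Q : View} {K : PropForm ℕ} {W i : ℕ} (hi : i < W) :
    ctx K (eqv (P.x i) (Q.x i)) ∈ cancelLines P Q K W := by
  rw [← cancelLine_odd P Q K i]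
  exact mem_map_range (by omega)

/-- Size of the cancellation law. [folklore] -/
theorem proofSize_cancelLines (P Q : View) (K : PropForm ℕ) (W : ℕ) :
    proofSize (cancelLines P Q K W) ≤ 2 * W * (K.size + 10) :=
  proofSize_map_range_le fun k _ => by
    unfold cancelLine
    split_ifs <;> simp [ctx, eqv, size, FregeSystem.size_biimp]

/-! #### Associativity -/

/-- The `W+1`-bit output word of a `W`-bit adder view: sum bits, then the carry-out.
[folklore] -/
def extOut (A : View) (W i : ℕ) : ℕ := if i < W then A.s i else A.c W

/-- A `W`-bit word extended by the variable `f` (meant to be a constant `⊥`) at position `W`.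
[folklore] -/
def zext (z : ℕ → ℕ) (f W i : ℕ) : ℕ := if i < W then z i else f

/-- Low positions of the output word. [folklore] -/
theorem extOut_lt (A : View) {W i : ℕ} (hi : i < W) : extOut A W i = A.s i := if_pos hi

/-- The top position of the output word. [folklore] -/
theorem extOut_top (A : View) (W : ℕ) : extOut A W W = A.c W := if_neg (lt_irrefl W)

/-- Low positions of the extended word. [folklore] -/
theorem zext_lt (z : ℕ → ℕ) (f : ℕ) {W i : ℕ} (hi : i < W) : zext z f W i = z i := if_pos hi

/-- The top position of the extended word. [folklore] -/
theorem zext_top (z : ℕ → ℕ) (f W : ℕ) : zext z f W W = f := if_neg (lt_irrefl W)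

/-- The four adders of the associativity law `(u + v) + z` versus `u + (v + z)`: `A = u + v`,
`B = A + z` (on `W+1` bits), `C = v + z`, `D = u + C` (on `W+1` bits); `f` is a `⊥` variable
padding the `W`-bit operands. [folklore] -/
structure AssocData where
  /-- base of `A = u + v` -/
  bA : ℕ
  /-- base of `B = (u + v) + z` -/
  bB : ℕ
  /-- base of `C = v + z` -/
  bC : ℕ
  /-- base of `D = u + (v + z)` -/
  bD : ℕ
  /-- first operand -/
  u : ℕ → ℕ
  /-- second operand -/
  v : ℕ → ℕ
  /-- third operand -/
  z : ℕ → ℕ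
  /-- a variable carrying `⊥` -/
  f : ℕ
  /-- the width of the operands -/
  W : ℕ

namespace AssocData

/-- `A = u + v`. [folklore] -/
def A (d : AssocData) : View := ⟨d.bA, d.u, d.v⟩
/-- `C = v + z`. [folklore] -/
def C (d : AssocData) : View := ⟨d.bC, d.v, d.z⟩
/-- `B = (u + v) + z` on `W + 1` bits. [folklore] -/
def B (d : AssocData) : View := ⟨d.bB, extOut d.A d.W, zext d.z d.f d.W⟩
/-- `D = u + (v + z)` on `W + 1` bits. [folklore] -/
def D (d : AssocData) : View := ⟨d.bD, zext d.u d.f d.W, extOut d.C d.W⟩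

/-- The invariant line at position `i`. [folklore] -/
def invLine (d : AssocData) (K : PropForm ℕ) (i : ℕ) : PropForm ℕ :=
  ctx K (invF (var (d.A.c i)) (var (d.B.c i)) (var (d.C.c i)) (var (d.D.c i)))

/-- The lines of the associativity law: invariants (even positions `≤ 2W`), sum-bit equalities
`sᵢ(B) ↔ sᵢ(D)` (odd positions), and finally the carry-out equality (position `2W+2`).
[folklore] -/
def line (d : AssocData) (K : PropForm ℕ) (k : ℕ) : PropForm ℕ :=
  if k = 2 * d.W + 2 then ctx K (eqv (d.B.c (d.W + 1)) (d.D.c (d.W + 1)))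
  else if k % 2 = 0 then d.invLine K (k / 2) else ctx K (eqv (d.B.s (k / 2)) (d.D.s (k / 2)))

/-- Invariant positions. [folklore] -/
theorem line_inv (d : AssocData) (K : PropForm ℕ) {i : ℕ} (hi : i ≤ d.W) :
    d.line K (2 * i) = d.invLine K i := by
  rw [line, if_neg (by omega), if_pos (by omega), show 2 * i / 2 = i by omega]

/-- Sum positions. [folklore] -/
theorem line_sum (d : AssocData) (K : PropForm ℕ) (i : ℕ) :
    d.line K (2 * i + 1) = ctx K (eqv (d.B.s i) (d.D.s i)) := by
  rw [line, if_neg (by omega), if_neg (by omega), show (2 * i + 1) / 2 = i by omega]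

/-- The carry-out position. [folklore] -/
theorem line_top (d : AssocData) (K : PropForm ℕ) :
    d.line K (2 * d.W + 2) = ctx K (eqv (d.B.c (d.W + 1)) (d.D.c (d.W + 1))) := by
  rw [line, if_pos rfl]

/-- The block of the associativity law. [folklore] -/
def lines (d : AssocData) (K : PropForm ℕ) : List (PropForm ℕ) :=
  (List.range (2 * d.W + 3)).map (d.line K)

/-- **Associativity of ripple-carry addition inside Frege.** With `A = u + v`, `B = A + z`,
`C = v + z`, `D = u + C` (the latter two on `W+1` bits, the `W`-bit operands padded by a
provably false variable `f`), the sum bits and the carry-out of `B` and `D` are provably equal: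
an induction along the positions carrying the invariant `cᵢ(A) + cᵢ(B) = cᵢ(C) + cᵢ(D)`.
[cite: CookReckhow1979, §2] -/
theorem isBlock_lines (hG : ∀ r ∈ lawRules, r ∈ G.rules) (d : AssocData)
    (hA : d.A.Avail K Γ false d.W) (hB : d.B.Avail K Γ false (d.W + 1))
    (hC : d.C.Avail K Γ false d.W) (hD : d.D.Avail K Γ false (d.W + 1))
    (hf : ctx K (neg (var d.f)) ∈ Γ) : G.IsBlock Γ (d.lines K) := by
  have hBx : ∀ i < d.W, d.B.x i = d.A.s i := fun i hi => extOut_lt d.A hi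
  have hBy : ∀ i < d.W, d.B.y i = d.z i := fun i hi => zext_lt d.z d.f hi
  have hDx : ∀ i < d.W, d.D.x i = d.u i := fun i hi => zext_lt d.u d.f hi
  have hDy : ∀ i < d.W, d.D.y i = d.C.s i := fun i hi => extOut_lt d.C hi
  have hBxW : d.B.x d.W = d.A.c d.W := extOut_top d.A d.W
  have hByW : d.B.y d.W = d.f := zext_top d.z d.f d.W
  have hDxW : d.D.x d.W = d.f := zext_top d.u d.f d.W
  have hDyW : d.D.y d.W = d.C.c d.W := extOut_top d.C d.W
  refine isBlock_map_range (2 * d.W + 3) fun k hk => Or.inr ?_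
  by_cases htop : k = 2 * d.W + 2
  · -- the carry-out
    subst htop
    rw [line_top]
    have h₁ := (hB.2 d.W (Nat.lt_succ_self _)).2
    have h₂ := (hD.2 d.W (Nat.lt_succ_self _)).2
    rw [View.carryDef, hBxW, hByW] at h₁
    rw [View.carryDef, hDxW, hDyW] at h₂
    exact FregeSystem.IsInferredFrom.of_rule (hG _ mem_lawRules.2.2.2.2.2.2.2.2)
      (FregeSystem.sub [K, var (d.A.c d.W), var (d.B.c d.W), var (d.C.c d.W), var (d.D.c d.W),
        var d.f, var d.f, var (d.B.c (d.W + 1)), var (d.D.c (d.W + 1))]) rfl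
      (FregeSystem.prems_cons (Or.inr ⟨2 * d.W, by omega, (d.line_inv K le_rfl).symm⟩)
        (FregeSystem.prems_cons (Or.inl hf) (FregeSystem.prems_cons (Or.inl hf)
        (FregeSystem.prems_cons (Or.inl h₁) (FregeSystem.prems_cons (Or.inl h₂)
        FregeSystem.prems_nil)))))
  rcases index_cases (d.W + 1) k (by omega) with rfl | ⟨i, hi, rfl | rfl⟩
  · -- the base of the invariant
    rw [show (0 : ℕ) = 2 * 0 from rfl, d.line_inv K (Nat.zero_le _)]
    exact FregeSystem.IsInferredFrom.of_rule (hG _ mem_lawRules.2.2.2.2.1)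
      (FregeSystem.sub [K, var (d.A.c 0), var (d.B.c 0), var (d.C.c 0), var (d.D.c 0)]) rfl
      (FregeSystem.prems_cons (Or.inl hA.1) (FregeSystem.prems_cons (Or.inl hB.1)
        (FregeSystem.prems_cons (Or.inl hC.1) (FregeSystem.prems_cons (Or.inl hD.1)
        FregeSystem.prems_nil))))
  · -- a sum position `i ≤ W`
    rw [d.line_sum K]
    rcases Nat.lt_succ_iff_lt_or_eq.1 hi with hi | rfl
    · have h₁ := (hB.2 i (by omega)).1
      have h₂ := (hD.2 i (by omega)).1
      rw [View.sumDef, hBx i hi, hBy i hi] at h₁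
      rw [View.sumDef, hDx i hi, hDy i hi] at h₂
      exact FregeSystem.IsInferredFrom.of_rule (hG _ mem_lawRules.2.2.2.2.2.1)
        (FregeSystem.sub [K, var (d.u i), var (d.v i), var (d.z i), var (d.A.c i), var (d.B.c i),
          var (d.C.c i), var (d.D.c i), var (d.A.s i), var (d.C.s i), var (d.B.s i), var (d.D.s i)])
        rfl
        (FregeSystem.prems_cons (Or.inr ⟨2 * i, by omega, (d.line_inv K (by omega)).symm⟩)
          (FregeSystem.prems_cons (Or.inl (hA.2 i hi).1) (FregeSystem.prems_cons (Or.inl (hC.2 i hi).1)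
          (FregeSystem.prems_cons (Or.inl h₁) (FregeSystem.prems_cons (Or.inl h₂)
          FregeSystem.prems_nil)))))
    · -- the top sum bit
      have h₁ := (hB.2 d.W (Nat.lt_succ_self _)).1
      have h₂ := (hD.2 d.W (Nat.lt_succ_self _)).1
      rw [View.sumDef, hBxW, hByW] at h₁
      rw [View.sumDef, hDxW, hDyW] at h₂
      exact FregeSystem.IsInferredFrom.of_rule (hG _ mem_lawRules.2.2.2.2.2.2.2.1)
        (FregeSystem.sub [K, var (d.A.c d.W), var (d.B.c d.W), var (d.C.c d.W), var (d.D.c d.W),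
          var d.f, var d.f, var (d.B.s d.W), var (d.D.s d.W)]) rfl
        (FregeSystem.prems_cons (Or.inr ⟨2 * d.W, by omega, (d.line_inv K le_rfl).symm⟩)
          (FregeSystem.prems_cons (Or.inl hf) (FregeSystem.prems_cons (Or.inl hf)
          (FregeSystem.prems_cons (Or.inl h₁) (FregeSystem.prems_cons (Or.inl h₂)
          FregeSystem.prems_nil)))))
  · -- an invariant position `i + 1 ≤ W`
    have hiW : i < d.W := by omega
    rw [show 2 * i + 2 = 2 * (i + 1) by ring, d.line_inv K (by omega)]
    have h₁ := (hB.2 i (by omega)).2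
    have h₂ := (hD.2 i (by omega)).2
    rw [View.carryDef, hBx i hiW, hBy i hiW] at h₁
    rw [View.carryDef, hDx i hiW, hDy i hiW] at h₂
    exact FregeSystem.IsInferredFrom.of_rule (hG _ mem_lawRules.2.2.2.2.2.2.1)
      (FregeSystem.sub [K, var (d.u i), var (d.v i), var (d.z i), var (d.A.c i), var (d.B.c i),
        var (d.C.c i), var (d.D.c i), var (d.A.s i), var (d.C.s i), var (d.A.c (i + 1)),
        var (d.B.c (i + 1)), var (d.C.c (i + 1)), var (d.D.c (i + 1))]) rfl
      (FregeSystem.prems_cons (Or.inr ⟨2 * i, by omega, (d.line_inv K (by omega)).symm⟩)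
        (FregeSystem.prems_cons (Or.inl (hA.2 i hiW).1) (FregeSystem.prems_cons (Or.inl (hC.2 i hiW).1)
        (FregeSystem.prems_cons (Or.inl (hA.2 i hiW).2) (FregeSystem.prems_cons (Or.inl h₁)
        (FregeSystem.prems_cons (Or.inl (hC.2 i hiW).2) (FregeSystem.prems_cons (Or.inl h₂)
        FregeSystem.prems_nil)))))))

/-- Conclusions of the associativity law: the sum bits of `B` and `D` agree (`i ≤ W`).
[folklore] -/
theorem sum_mem_lines (d : AssocData) (K : PropForm ℕ) {i : ℕ} (hi : i ≤ d.W) :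
    ctx K (eqv (d.B.s i) (d.D.s i)) ∈ d.lines K := by
  rw [← d.line_sum K i]
  exact mem_map_range (by omega)

/-- Conclusions of the associativity law: the carry-outs of `B` and `D` agree. [folklore] -/
theorem carry_mem_lines (d : AssocData) (K : PropForm ℕ) :
    ctx K (eqv (d.B.c (d.W + 1)) (d.D.c (d.W + 1))) ∈ d.lines K := by
  rw [← d.line_top K]
  exact mem_map_range (by omega)

/-- Size of the associativity law: `2W + 3` lines of size `≤ |K| + 60`. [folklore] -/
theorem proofSize_lines (d : AssocData) (K : PropForm ℕ) :
    proofSize (d.lines K) ≤ (2 * d.W + 3) * (K.size + 60) :=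
  proofSize_map_range_le fun k _ => by
    unfold line invLine
    split_ifs <;> simp [ctx, eqv, invF, size, FregeSystem.size_biimp]

end AssocData

end Adder

end Literature.Computability.MetaComplexity
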